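import Mathlib
import HarnessLib
import Summits.NavierStokesRegularity.NavierStokesRegularity.Theses.LocalLambTubeDoor

/-!
# Route `LocalLambTubeDoor` (S12, rung N0-LocalTubeDoorLamb) — the ASSEMBLY

Cell ns-regularity-ideate, seat p6 (birth filing; the route was opened from the staged package
HOME/ns-regularity-ideate-p6/route-lamb/).  Both cruxes are tree theorems (K1 = `localPointZoomVelGradSlices` p441522,
K2 ⇐ `not_backwardSingular_of_beltrami` p455778); this file records the assembly BY NAME against the born Theses decl
through the gate-certified deciding theorem `closes` (closing item stmt-NavierStokesRegularity-19816).

WHAT THIS IS NOT: not a claim about Navier–Stokes regularity (Clay A).  The leaf is a regularity CRITERION (local Type I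
+ L¹-fading of the scale-normalised Lamb vector (T−t)^{3/2}·u × curl u on ONE similarity window ⇒ backward bounded), one
rung of LADDER-NS N0 (N0-LocalTubeDoorLamb); establishment in the cell's sense still requires the cross-family referee
PASS + independent reproduction.
-/

noncomputable section

-- the summit and its single sub-problem share the name (CONVENTIONS §1), as in every Theorems file
set_option linter.dupNamespace false

namespace Summit.NavierStokesRegularity.NavierStokesRegularity.Theorems.LocalLambTubeDoorAssembly

open Summit.NavierStokesRegularity.NavierStokesRegularity.Theses.LocalLambTubeDoor

/-- **The route's `Assembly` (item stmt-NavierStokesRegularity-19816)**: `LocalPointZoomVelGradSlices → BeltramiWindowRigidity → Target`,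
by the gate-certified deciding theorem `closes`. -/
theorem assembly_proof :
    Summit.NavierStokesRegularity.NavierStokesRegularity.Theses.LocalLambTubeDoor.Assembly :=
  fun h₁ h₂ => closes h₁ h₂

end Summit.NavierStokesRegularity.NavierStokesRegularity.Theorems.LocalLambTubeDoorAssembly

end
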